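import Summits.QuantumFields.GaugeBoot.Rows.SymGram
import Summits.QuantumFields.GaugeBoot.Rows.RedEnc
import HarnessLib

/-!
# Gauge-boot: symmetry kit `SymFam` — the three raw positivity families as instances of the symmetry-factorised block theorem

Cell `pub-gaugeboot` (HOME `run/shared/lean/pub/pub-gaugeboot/`), seat lean1 (torus layer for the kz-L2-rp-4D family; reusable for
every `D = 4` family).  HONEST FRAMING (page 1 of every file of this cell): certified bounds on lattice expectations at STATED coupling,
gauge group, dimension and torus size; NOT a mass gap, NOT a continuum limit, NOT a string tension, NOT large `N`.
The venture is explicitly NOT Yang–Mills-summit-bearing (barriers `FixedCouplingUltralocality`, `PerturbativeInvisibility`).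

Discharges the hypotheses `GSymm` / `GInv` / `GPsd` of `SymB4.symBlock_posSemidef` for the torus functionals
`⟨W_0(x⁻¹z)⟩` (Hermitian Gram, any torus, any β), `⟨W_0((θ'x)⁻¹z)⟩` (site reflection, even `L`, half-space words of height `≤ B`, `2B ≤ L`)
and `⟨W_0((θ'x)⁻¹(+e₀)z(−e₀))⟩` (link reflection, even `L`, `β ≥ 0`) from the tree (`sum_mul_wilsonExpectation_wordLoop_nonneg`,
`…_reflect0_nonneg`, `…_linkReflect_nonneg`) and the invariance lemmas of `SymGram`, giving `symBlockH/S/L_posSemidef`; plus the entry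
symmetry `symBlock_symm` and the radix-check glue `eval_expand_singleton` (a singleton left factor turns `RedEnc.encCheck` into a check of
ONE weighted orbit sum against lean3's entry).  [folklore]
-/

noncomputable section

open Literature.MathematicalPhysics.QuantumFieldTheory
open Finset Matrix
open Summit.QuantumFields.GaugeBoot.GLYZc2D3 (SVec)

namespace Summit.QuantumFields.GaugeBoot

namespace SymB4

variable (β : ℝ) (L : ℕ) [NeZero L]

/-! ## The three torus functionals -/

/-- `G_H(x,z) = ⟨W_0(x⁻¹z)⟩`. -/
def gramH (x z : Word 4) : ℝ := Rung0D4.W β L (rawHw x z)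

/-- `G_S(x,z) = ⟨W_0((θ'x)⁻¹z)⟩`. -/
def gramS (x z : Word 4) : ℝ := Rung0D4.W β L (rawSw x z)

/-- `G_L(x,z) = ⟨W_0((θ'x)⁻¹·(+e₀)·z·(−e₀))⟩`. -/
def gramL (x z : Word 4) : ℝ := Rung0D4.W β L (rawLw x z)

/-- `G_H` is symmetric on closed words. -/
theorem GSymm_H : GSymm (gramH β L) := fun x z hx hz => by
  unfold gramH
  have hd : Word.disp (rawHw x z) = 0 := by simp [rawHw, hx, hz]
  rw [show rawHw z x = Word.reverse (rawHw x z) from (GLYZc1D4.wordReverse_rawH x z).symm, GLYZc1D4.W_wordReverse β L _ hd]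

/-- `G_S` is symmetric on closed words. -/
theorem GSymm_S : GSymm (gramS β L) := fun x z hx hz => by
  unfold gramS
  have hd : Word.disp (rawSw x z) = 0 := by simp [rawSw, hz, Word.disp_map_reflect0_eq_zero hx]
  rw [show rawSw z x = (Word.reverse (rawSw x z)).map Step.reflect0 from (GLYZc1D4.reflect_wordReverse_rawS x z).symm,
    GLYZc1D4.W_map_reflect0, GLYZc1D4.W_wordReverse β L _ hd]

/-- `G_L` is symmetric on closed words. -/
theorem GSymm_L : GSymm (gramL β L) := fun x z hx hz => by
  unfold gramL
  have hd : Word.disp (rawLw x z) = 0 := by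
    simp [rawLw, hz, Word.disp_map_reflect0_eq_zero hx, Step.disp]
  have hd' : Word.disp ((Word.reverse (rawLw x z)).map Step.reflect0) = 0 := by
    rw [Word.disp_map_reflect0_eq_zero]; simp [hd]
  rw [show rawLw z x = ((Word.reverse (rawLw x z)).map Step.reflect0).rotate 1 from
    (GLYZc1D4.rotate_reflect_wordReverse_rawL x z).symm, GLYZc1D4.W_rotate β L _ hd', GLYZc1D4.W_map_reflect0,
    GLYZc1D4.W_wordReverse β L _ hd]

/-- `G_H` is invariant under every code. -/
theorem GInv_H : GInv (gramH β L) (fun _ => True) := fun u _ x z hx hz => W_rawHw_gactT β L u x z hx hz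

/-- `G_S` is invariant under the time-axis-fixing codes. -/
theorem GInv_S : GInv (gramS β L) Fix0 := fun u hu x z hx hz => W_rawSw_gactT β L u hu x z hx hz

/-- `G_L` is invariant under the time-axis-fixing codes. -/
theorem GInv_L : GInv (gramL β L) Fix0 := fun u hu x z hx hz => W_rawLw_gactT β L u hu x z hx hz

/-- `Fix0` is closed under inverses. -/
theorem fix0_inv (u : Fin 768) (h : Fix0 u.val) : Fix0 (inv u.val) := by
  unfold Fix0 at h ⊢
  conv_lhs => rw [← h]
  exact (smapT_inv_smapT u 0).1

/-- `G_H` is Gram-positive on every closed family (every torus, every real `β`). -/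
theorem GPsd_H : GPsd (gramH β L) (fun _ => True) := fun _ O hO _ a =>
  sum_mul_wilsonExpectation_wordLoop_nonneg (suRep 2) (continuous_suRep 2) _ (0 : Site 4 L) O
    (fun i => Word.endpoint_eq_self_of_disp 0 (hO i)) a

/-- `G_S` is Gram-positive on closed half-space families of height `≤ B` (even `L`, `2B ≤ L`). -/
theorem GPsd_S (hL : Even L) {B : ℕ} (hB : 2 * B ≤ L) : GPsd (gramS β L) (fun w => Word.siteHalfOK B w 0 = true) :=
  fun _ O hO hok a => sum_mul_wilsonExpectation_wordLoop_reflect0_nonneg (suRep 2) hL (continuous_suRep 2) _ O hB hok hO a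

/-- `G_L` is Gram-positive on closed positive-time families of height `≤ B` (even `L`, `2B ≤ L`, `β ≥ 0`). -/
theorem GPsd_L (hL : Even L) (hβ : 0 ≤ β) {B : ℕ} (hB : 2 * B ≤ L) :
    GPsd (gramL β L) (fun w => Word.linkHalfOK B w (Pi.single 0 1) = true) := fun _ O hO hok a => by
  have hβ' : 0 ≤ β / (2 : ℕ) := by positivity
  exact sum_mul_wilsonExpectation_wordLoop_linkReflect_nonneg (suRep 2) hL (continuous_suRep 2) hβ' O hB hok hO a

/-! ## The block theorems for the three families -/

section Blocks

variable {nT : ℕ} (tc : Fin nT → Fin 768) (c : ℕ → ℤ) (den : ℕ) {m : ℕ} (x : Fin m → Word 4) (s : Fin m → ℤ)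

/-- **Hermitian family**: `(den/(s_i s_j))·Σ_t c_t·⟨W_0(x_i⁻¹ (t·x_j))⟩` is PSD (every torus, every real `β`). -/
theorem symBlockH_posSemidef (htinj : Function.Injective tc) (hcT : ∀ u : Fin 768, c u.val ≠ 0 → ∃ t, tc t = u)
    (hden : 0 < den) (hC1 : ∀ w : Fin 768, ∑ t, c (tc t).val * c (mul (tc t).val w.val) = den * c w.val)
    (hx : ∀ i, Word.disp (x i) = 0) (hs : ∀ i, s i ≠ 0) :
    (Matrix.of fun i j : Fin m => (den : ℝ) / (s i * s j) *
      ∑ t, (c (tc t).val : ℝ) * Rung0D4.W β L (rawHw (x i) (gactT (tc t).val (x j)))).PosSemidef :=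
  symBlock_posSemidef tc c (GSymm_H β L) (GInv_H β L) (fun _ _ => trivial) (GPsd_H β L) htinj (fun _ => trivial) hcT den hden
    hC1 x hx (fun _ _ => trivial) s hs

/-- **Site-reflection family**: the same for `⟨W_0((θ'x_i)⁻¹(t·x_j))⟩`, time-axis-fixing support, orbit words of height `≤ B`. -/
theorem symBlockS_posSemidef (hL : Even L) {B : ℕ} (hB : 2 * B ≤ L) (htinj : Function.Injective tc)
    (hstab : ∀ t, Fix0 (tc t).val) (hcT : ∀ u : Fin 768, c u.val ≠ 0 → ∃ t, tc t = u)
    (hden : 0 < den) (hC1 : ∀ w : Fin 768, ∑ t, c (tc t).val * c (mul (tc t).val w.val) = den * c w.val)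
    (hx : ∀ i, Word.disp (x i) = 0) (hok : ∀ t i, Word.siteHalfOK B (gactT (tc t).val (x i)) 0 = true) (hs : ∀ i, s i ≠ 0) :
    (Matrix.of fun i j : Fin m => (den : ℝ) / (s i * s j) *
      ∑ t, (c (tc t).val : ℝ) * Rung0D4.W β L (rawSw (x i) (gactT (tc t).val (x j)))).PosSemidef :=
  symBlock_posSemidef tc c (GSymm_S β L) (GInv_S β L) fix0_inv (GPsd_S β L hL hB) htinj hstab hcT den hden hC1 x hx hok s hs

/-- **Link-reflection family**: the same for `⟨W_0((θ'x_i)⁻¹(+e₀)(t·x_j)(−e₀))⟩` (even `L`, `2B ≤ L`, `β ≥ 0`). -/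
theorem symBlockL_posSemidef (hL : Even L) (hβ : 0 ≤ β) {B : ℕ} (hB : 2 * B ≤ L) (htinj : Function.Injective tc)
    (hstab : ∀ t, Fix0 (tc t).val) (hcT : ∀ u : Fin 768, c u.val ≠ 0 → ∃ t, tc t = u)
    (hden : 0 < den) (hC1 : ∀ w : Fin 768, ∑ t, c (tc t).val * c (mul (tc t).val w.val) = den * c w.val)
    (hx : ∀ i, Word.disp (x i) = 0) (hok : ∀ t i, Word.linkHalfOK B (gactT (tc t).val (x i)) (Pi.single 0 1) = true)
    (hs : ∀ i, s i ≠ 0) :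
    (Matrix.of fun i j : Fin m => (den : ℝ) / (s i * s j) *
      ∑ t, (c (tc t).val : ℝ) * Rung0D4.W β L (rawLw (x i) (gactT (tc t).val (x j)))).PosSemidef :=
  symBlock_posSemidef tc c (GSymm_L β L) (GInv_L β L) fix0_inv (GPsd_L β L hL hβ hB) htinj hstab hcT den hden hC1 x hx hok s hs

/-- **Entry symmetry** of the factorised block (so that only `i ≤ j` needs a kernel identity). -/
theorem symBlock_symm {G : Word 4 → Word 4 → ℝ} {stab : ℕ → Prop} (hGs : GSymm G) (hGi : GInv G stab)
    (hstabinv : ∀ u : Fin 768, stab u.val → stab (inv u.val)) (htinj : Function.Injective tc) (hstab : ∀ t, stab (tc t).val)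
    (hcT : ∀ u : Fin 768, c u.val ≠ 0 → ∃ t, tc t = u) (hden : 0 < den)
    (hC1 : ∀ w : Fin 768, ∑ t, c (tc t).val * c (mul (tc t).val w.val) = den * c w.val)
    (hx : ∀ i, Word.disp (x i) = 0) (i j : Fin m) :
    (den : ℝ) / (s i * s j) * ∑ t, (c (tc t).val : ℝ) * G (x i) (gactT (tc t).val (x j)) =
      (den : ℝ) / (s j * s i) * ∑ t, (c (tc t).val : ℝ) * G (x j) (gactT (tc t).val (x i)) := by
  have hden' : (den : ℝ) ≠ 0 := by exact_mod_cast hden.ne'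
  have hi := single_sum_eq_double_sum tc c hGi hstabinv htinj hstab hcT den hC1 (x i) (x j) (hx i) (hx j)
  have hj := single_sum_eq_double_sum tc c hGi hstabinv htinj hstab hcT den hC1 (x j) (x i) (hx j) (hx i)
  have hD : ∑ t, ∑ t', (c (tc t).val : ℝ) * (c (tc t').val : ℝ) * G (gactT (tc t).val (x i)) (gactT (tc t').val (x j)) =
      ∑ t, ∑ t', (c (tc t).val : ℝ) * (c (tc t').val : ℝ) * G (gactT (tc t).val (x j)) (gactT (tc t').val (x i)) := by
    rw [Finset.sum_comm]
    refine Finset.sum_congr rfl fun t' _ => Finset.sum_congr rfl fun t _ => ?_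
    rw [hGs (gactT (tc t).val (x i)) (gactT (tc t').val (x j)) (disp_gactT (tc t) (hx i)) (disp_gactT (tc t') (hx j))]
    ring
  have hA : ∑ t, (c (tc t).val : ℝ) * G (x i) (gactT (tc t).val (x j)) = ∑ t, (c (tc t).val : ℝ) * G (x j) (gactT (tc t).val (x i)) := by
    have := hi.trans (hD.trans hj.symm)
    exact mul_left_cancel₀ hden' this
  rw [hA, mul_comm (s i : ℝ) (s j)]

end Blocks

/-! ## Radix-check glue: a singleton left factor -/

/-- `eval` of the expansion with the singleton left factor `[(a, d)]` is ONE weighted sum over the right factor. -/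
theorem eval_expand_singleton (g : ℕ → ℝ) (a : ℕ) (d : ℤ) (cls : ℕ → ℕ → ℕ) :
    ∀ cj : SVec, GLYZc2D3.SVec.eval g (GLYZc2D3.SVec.expand [(a, d)] cj cls) = (d : ℝ) * (cj.map fun q => (q.2 : ℝ) * g (cls a q.1)).sum
  | [] => by simp [GLYZc2D3.SVec.expand, GLYZc2D3.SVec.eval]
  | q :: t => by
    have ih := eval_expand_singleton g a d cls t
    simp only [GLYZc2D3.SVec.expand, List.flatMap_cons, List.flatMap_nil, List.append_nil, List.map_cons] at ih ⊢
    rw [GLYZc2D3.SVec.eval_cons, ih, List.sum_cons]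
    push_cast
    ring

end SymB4

end Summit.QuantumFields.GaugeBoot

end
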